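import Summits.HodgeConjecture.HodgeConjecture.Theorems.MilnorKExponentialDefs
import Summits.HodgeConjecture.HodgeConjecture.Theorems.MilnorKExponentialSymbolClassesHodgeType
import Literature.AlgebraicGeometry.HodgeTheory.HolomorphicBundleChernCharacter

/-!
# Line `Sketch` (idea `steinberg-lifting-gerbe`) for the crux `SymbolClassesAlgebraic` — COSTUME CERTIFICATE

Lead c1 (prover-line-stmt-HodgeConjecture-17743-c1-0), 2026-08-17. The second line handed to the lead
for the crux GK_p (`MilnorKExponential.SymbolClassesAlgebraic`, stmt-HodgeConjecture-17743) is the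
planner's `Sketch.lean` of the idea card `Cruxes/SymbolClassesAlgebraic/Ideas/steinberg-lifting-gerbe.md`
(crux-ideate r1 k2). Its transferred statement is E2 = `SteinbergGeneration` below (signature verbatim
from the card): every rational symbol class lies, on EVERY Hodge model, in the `ℂ`-span of the Chern
characters of holomorphic vector bundles. The card itself records that E2 is "truth-value EQUIVALENT to
GK" given the tree's named fact `span_holomorphicBundleChernCharacter_eq_algebraicClasses` (Voisin I,
Thm. 11.32 ⊗ ℂ; UNPROVED in the tree). This file makes that precise and sorry-free, separating the two
halves of the fact:

* `gkNamed_of_steinbergGeneration` — E2 ∧ (⊆ half: Chern characters of holomorphic bundles are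
  algebraic) ⇒ GK (the card's reduction `gkNamed_of_steinbergGeneration`, re-proved);
* `steinbergGeneration_of_gkNamed` — GK ∧ (⊇ half: algebraic classes are spanned by Chern characters)
  ⇒ E2 (the COSTUME direction: the line's only would-be stub is implied by the crux);
* `steinbergGeneration_iff_symbolClassesAlgebraic` — modulo Thm. 11.32 ⊗ ℂ the line's C⁺ IS the route
  decl;
* `steinbergGeneration_of_hodgeConjecture` — hence, like the crux (`Negative/Ceiling`), E2 sits below
  `HodgeConjecture` (given the ⊇ half), and is not refutable short of a counterexample to HC.

Consequence for the line chain: as a LINE (skeleton with stubs) `Sketch` offers no stub strictly below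
the crux — its composition is `E2 → (⊆ half) → GK`, E2 ⟺ GK, and the output side is conditional on an
XL unproved fact. The card's genuine content (read a symbol 2-cocycle as the Steinberg lifting
obstruction of an `SL_N(𝒪^an)`-cocycle; Brylinski–McLaughlin: its transgression is `±(2πi)² c₂`) is a
proof STRATEGY for the GK-equivalent global-solvability statement, for which the card offers "the bet",
not a printed plan. Verdict: line-dead (costume), see `Lines/Sketch.dead.md`.
-/

noncomputable section

-- mandated namespace repeats `HodgeConjecture` (single-conjunct summit)
set_option linter.dupNamespace false

namespace Summit.HodgeConjecture.HodgeConjecture.Cruxes.SymbolClassesAlgebraic.SteinbergCostume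

open Literature.AlgebraicGeometry.HodgeTheory Literature.AlgebraicGeometry.Motives
open Summit.HodgeConjecture.HodgeConjecture.Theorems.MilnorKExponentialNash
  (GKNamed route_of_gkNamed gkNamed_of_route)
open Summit.HodgeConjecture.HodgeConjecture.Theses.MilnorKExponential (SymbolClassesAlgebraic)

/-- **E2 of the card `steinberg-lifting-gerbe` (`SteinbergGeneration`, signature verbatim):** on a
smooth projective complex variety, for EVERY Hodge model `A`, every rational symbol class of weight
`q + 1` lies in the `ℂ`-span of the `(q+1)`-st Chern characters of the holomorphic vector bundles on
`X^an`. Route-posited STATEMENT (the line's transferred crux C⁺), not a result. -/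
def SteinbergGeneration : Prop :=
  ∀ ⦃n : ℕ⦄ ⦃X : SchemeOver ℂ⦄, IsSmoothProjective n X →
    ∀ (A : HodgeModel n X) (q : ℕ) (c : complexBetti X (2 * (q + 1))), IsRationalClass c →
      IsSymbolClass n X q c → c ∈ Submodule.span ℂ (A.holomorphicBundleChernCharacter (q + 1))

/-- **The ⊆ half of Voisin I Thm. 11.32 ⊗ ℂ**: on a smooth projective variety the Chern characters of
holomorphic vector bundles (on any Hodge model) span a subspace of the algebraic classes (GAGA: the
bundle is algebraic; Chern classes of algebraic bundles are algebraic cycle classes). Statement only. -/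
def ChernCharactersAlgebraic : Prop :=
  ∀ ⦃n : ℕ⦄ ⦃X : SchemeOver ℂ⦄, IsSmoothProjective n X →
    ∀ (A : HodgeModel n X) (p : ℕ),
      Submodule.span ℂ (A.holomorphicBundleChernCharacter p) ≤ algebraicClasses X p

/-- **The ⊇ half of Voisin I Thm. 11.32 ⊗ ℂ**: algebraic classes are `ℂ`-combinations of Chern
characters of holomorphic (= algebraic) vector bundles (resolve `𝒪_Z` by vector bundles;
Grothendieck–Riemann–Roch). Statement only. -/
def AlgebraicClassesAreChernCharacters : Prop :=
  ∀ ⦃n : ℕ⦄ ⦃X : SchemeOver ℂ⦄, IsSmoothProjective n X →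
    ∀ (A : HodgeModel n X) (p : ℕ),
      algebraicClasses X p ≤ Submodule.span ℂ (A.holomorphicBundleChernCharacter p)

/-- The tree's named fact (Thm. 11.32 ⊗ ℂ, an equality of spans) is exactly the conjunction of the
two halves. [folklore] -/
theorem chernCharactersAlgebraic_and_converse_iff :
    ChernCharactersAlgebraic ∧ AlgebraicClassesAreChernCharacters ↔
      span_holomorphicBundleChernCharacter_eq_algebraicClasses := by
  constructor
  · rintro ⟨hle, hge⟩ n X hX A p
    exact le_antisymm (hle hX A p) (hge hX A p)
  · intro h
    exact ⟨fun n X hX A p ↦ (h hX A p).le, fun n X hX A p ↦ (h hX A p).ge⟩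

/-- **E2 ∧ (⊆ half) ⇒ GK** — the card's reduction: a rational symbol class has a Hodge model `A`
(`IsSymbolClass.nonempty_hodgeModel`), lies in the span of Chern characters on `A` by E2, hence is
algebraic. [folklore] -/
theorem gkNamed_of_steinbergGeneration (hle : ChernCharactersAlgebraic) (h : SteinbergGeneration) :
    GKNamed := by
  intro n X hX q c hc hs
  obtain ⟨A⟩ := hs.nonempty_hodgeModel
  exact hle hX A (q + 1) (h hX A q c hc hs)

/-- **GK ∧ (⊇ half) ⇒ E2** — the COSTUME direction: under the crux a rational symbol class is
algebraic, hence in the span of Chern characters on every model. So E2 carries no content below the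
crux once Thm. 11.32 ⊗ ℂ is granted. [folklore] -/
theorem steinbergGeneration_of_gkNamed (hge : AlgebraicClassesAreChernCharacters) (h : GKNamed) :
    SteinbergGeneration := by
  intro n X hX A q c hc hs
  exact hge hX A (q + 1) (h hX q c hc hs)

/-- **Modulo Thm. 11.32 ⊗ ℂ, E2 ⟺ GK (named form).** [folklore] -/
theorem steinbergGeneration_iff_gkNamed (hfact : span_holomorphicBundleChernCharacter_eq_algebraicClasses) :
    SteinbergGeneration ↔ GKNamed :=
  have h := chernCharactersAlgebraic_and_converse_iff.2 hfact
  ⟨gkNamed_of_steinbergGeneration h.1, steinbergGeneration_of_gkNamed h.2⟩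

/-- **Modulo Thm. 11.32 ⊗ ℂ, the line's C⁺ IS the route decl `SymbolClassesAlgebraic`** (bridges
`route_of_gkNamed` / `gkNamed_of_route` of the crux's Defs file). [folklore] -/
theorem steinbergGeneration_iff_symbolClassesAlgebraic
    (hfact : span_holomorphicBundleChernCharacter_eq_algebraicClasses) :
    SteinbergGeneration ↔ SymbolClassesAlgebraic :=
  (steinbergGeneration_iff_gkNamed hfact).trans ⟨route_of_gkNamed, gkNamed_of_route⟩

/-- **E2 sits below the Hodge conjecture** (given the ⊇ half): HC ⇒ GK by the crux's ceiling (a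
rational symbol class is a rational `(q+1,q+1)`-class, `symbolClassesHodgeType_proof`, hence algebraic
under HC), then GK ⇒ E2. So E2 is not refutable short of a counterexample to `HodgeConjecture` (or to
Thm. 11.32). [folklore] -/
theorem steinbergGeneration_of_hodgeConjecture (hge : AlgebraicClassesAreChernCharacters)
    (hHC : _root_.HodgeConjecture) : SteinbergGeneration := by
  refine steinbergGeneration_of_gkNamed hge (gkNamed_of_route ?_)
  intro n X hX q c hc hs
  exact (hHC hX).2 (q + 1) c hc
    (Summit.HodgeConjecture.HodgeConjecture.Theorems.symbolClassesHodgeType_proof hX q c hc hs)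

end Summit.HodgeConjecture.HodgeConjecture.Cruxes.SymbolClassesAlgebraic.SteinbergCostume

end
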